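import Summits.ABC.ABC.Theses.CubicResolventAllowance
import Summits.ABC.ABC.Theorems.PlaceCountSzpiroPlaceBudgetPayoff
import Literature.NumberTheory.EllipticCurves.PastenValuationProductMestreOesterleProofs
import Literature.NumberTheory.DiophantineGeometry.MinimalDiscriminantProofs
import Literature.NumberTheory.DiophantineGeometry.MinimalDiscriminantFactorizationProofs
import Literature.NumberTheory.CubicFields.CubicFieldSignatureFromDiscriminant

/-!
# Stub ideation k=2, generation 4 (RESHAPE) — `stub_complexCubic` of crux `IndexSzpiro` (stmt-ABC-22740)

Elaboration sanity + kernel-checked glue for the gen-4 plan `STUB-IDEAS-stub_complexCubic-2.md`.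
Gen 1–3 of this slot reshaped the CURRENCY (kernel `SquarePartSzpiroNeg`, index form, place budget,
eventual form, `K`-elimination) — all sign-free.  Gen 4 reshapes the CUT ITSELF:

* §T1 the sign `d_K < 0` in Lean terms: it is `Δ(W) < 0` (given the square-ratio identity H1) and
  unit rank `1` of `K` (Brill, in tree) — the only typed places the sign can enter a size argument;
* §T2 the proposed RE-CUT of the skeleton, keeping a composition that concludes `IndexSzpiro` BY NAME:
  a `K`-free, sign-free kernel `OddTowerSzpiro` (Szpiro `6+ε` with the ODD-TOWER RADICAL as allowance)
  + the provable allowance lemma `AllowanceLe` (k3's L2 globalised) — `indexSzpiro_of_oddTower` PROVED;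
* §T3 an ε-free place-budget currency `PlaceBudgetOddTower` for the kernel, bootstrapped to the kernel by
  the tree lemma `pow_card_primeFactors_le` (`ω(N)! ≤ N`) — `oddTower_of_placeBudget` PROVED.

Scratch namespace; nothing here is a tree proposal.  `sorry` only in the body of the ONE helper that
is genuine prover work (R1 `allowanceDvd`, M: needs H1 `Δ(W) = q²·d_K` + k3's L2); everything else is
kernel-checked.
-/

open Polynomial

namespace Summit.ABC.ABC.Cruxes.IndexSzpiro.StubIdeas2G4

open Summit.ABC.ABC.Theorems.PlaceCountSzpiroPayoff
open Summit.ABC.ABC.Theses.CubicResolventAllowance (IndexSzpiro)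
open IsDedekindDomain Rat.HeightOneSpectrum

/-! ## §0 The two registered stubs, verbatim -/

/-- `stub_complexCubic` (signature verbatim). -/
def StubComplexCubic : Prop :=
  ∀ ε : ℝ, 0 < ε → ∃ C : ℝ, ∀ (W : WeierstrassCurve ℚ) [W.IsElliptic] (K : Type) [Field K]
    [NumberField K], Irreducible W.twoTorsionPolynomial.toPoly → Module.finrank ℚ K = 3 →
    (∃ θ : K, aeval θ W.twoTorsionPolynomial.toPoly = 0) → NumberField.discr K < 0 →
    (W.minimalDiscriminantNorm ℤ : ℝ) ≤
      C * |(NumberField.discr K : ℝ)| * (W.conductorNorm ℤ : ℝ) ^ (6 + ε)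

/-- `stub_realCubic` (signature verbatim). -/
def StubRealCubic : Prop :=
  ∀ ε : ℝ, 0 < ε → ∃ C : ℝ, ∀ (W : WeierstrassCurve ℚ) [W.IsElliptic] (K : Type) [Field K]
    [NumberField K], Irreducible W.twoTorsionPolynomial.toPoly → Module.finrank ℚ K = 3 →
    (∃ θ : K, aeval θ W.twoTorsionPolynomial.toPoly = 0) → 0 < NumberField.discr K →
    (W.minimalDiscriminantNorm ℤ : ℝ) ≤
      C * |(NumberField.discr K : ℝ)| * (W.conductorNorm ℤ : ℝ) ^ (6 + ε)

/-- (S, VERIFIED) the crux gives both stubs — the split loses nothing and, by §T1/§T2, gains nothing. -/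
theorem stubComplex_of_indexSzpiro (h : IndexSzpiro) : StubComplexCubic := by
  intro ε hε
  obtain ⟨C, hC⟩ := h ε hε
  exact ⟨C, fun W _ K _ _ hirr h3 hθ _ => hC W K hirr h3 hθ⟩

theorem stubReal_of_indexSzpiro (h : IndexSzpiro) : StubRealCubic := by
  intro ε hε
  obtain ⟨C, hC⟩ := h ε hε
  exact ⟨C, fun W _ K _ _ hirr h3 hθ _ => hC W K hirr h3 hθ⟩

/-! ## §T1 What `d_K < 0` IS, in typed terms (the sign dictionary's two Lean-visible entries) -/

/-- **H1′ (S, VERIFIED modulo the H1 instance).** Given the square-ratio identity `Δ(W) = q²·d_K`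
(k2 gen-1 `IndexSquareIdentity` / k3 H1 `DiscSqRatio`, M), the complex class is exactly `Δ(W) < 0`,
i.e. `E(ℝ)` connected, i.e. `ψ_W` has one real root. -/
theorem discr_neg_iff_Δ_neg (W : WeierstrassCurve ℚ) (K : Type) [Field K] [NumberField K]
    {q : ℚ} (hq : q ≠ 0) (hΔ : W.Δ = q ^ 2 * (NumberField.discr K : ℚ)) :
    NumberField.discr K < 0 ↔ W.Δ < 0 := by
  have hq2 : 0 < q ^ 2 := by positivity
  constructor
  · intro h
    rw [hΔ]
    exact mul_neg_of_pos_of_neg hq2 (by exact_mod_cast h)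
  · intro h
    rw [hΔ] at h
    refine lt_of_not_ge fun hc => ?_
    have : (0 : ℚ) ≤ q ^ 2 * (NumberField.discr K : ℚ) := mul_nonneg hq2.le (by exact_mod_cast hc)
    linarith

/-- **H2 (S, VERIFIED).** In the complex class `K` has unit rank `1` (one fundamental unit): Brill
(`nrRealPlaces_eq_one_iff_discr_neg_of_finrank_eq_three`, in tree) + `r₁ + 2 r₂ = 3`.  This is the one
place the sign enters any Baker/Thue–Mahler-type size argument over `K` (regulator, not exponent). -/
theorem unitRank_eq_one (K : Type) [Field K] [NumberField K] (h3 : Module.finrank ℚ K = 3)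
    (hd : NumberField.discr K < 0) : NumberField.Units.rank K = 1 := by
  have hr1 : NumberField.InfinitePlace.nrRealPlaces K = 1 :=
    (Literature.NumberTheory.CubicFields.nrRealPlaces_eq_one_iff_discr_neg_of_finrank_eq_three
      K h3).mpr hd
  have hsum := NumberField.InfinitePlace.card_add_two_mul_card_eq_rank K
  have hcard := NumberField.InfinitePlace.card_eq_nrRealPlaces_add_nrComplexPlaces K
  unfold NumberField.Units.rank
  omega

/-! ## §T2 The RE-CUT: `K`-free sign-free kernel + provable allowance lemma -/

/-- The ODD-TOWER RADICAL of `W`: the product of the primes at which `ord_p Δ_min` is odd. -/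
noncomputable def oddRadical (W : WeierstrassCurve ℚ) : ℕ :=
  ∏ p ∈ (W.minimalDiscriminantNorm ℤ).primeFactors.filter
      (fun p => Odd ((W.minimalDiscriminantNorm ℤ).factorization p)), p

theorem oddRadical_pos (W : WeierstrassCurve ℚ) : 0 < oddRadical W :=
  Finset.prod_pos fun _ hp => (Nat.prime_of_mem_primeFactors (Finset.mem_filter.mp hp).1).pos

/-- **K0 `OddTowerSzpiro` — the proposed kernel stub (OPEN, Szpiro-strength; `K`-free, sign-free).**
Szpiro `6+ε` where the primes with an ODD minimal-discriminant exponent are allowed one extra factor `p`.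
Implied by Szpiro `6+ε`; implies `IndexSzpiro` (R3); implied back by `IndexSzpiro` up to `N_add ≤ N`
(`v_p(d_K) ≤ 2`, `= 2` only at additive `p ≥ 5`), so it is the crux's content with `K` eliminated. -/
def OddTowerSzpiro : Prop :=
  ∀ ε : ℝ, 0 < ε → ∃ C : ℝ, ∀ (W : WeierstrassCurve ℚ) [W.IsElliptic],
    Irreducible W.twoTorsionPolynomial.toPoly →
    (W.minimalDiscriminantNorm ℤ : ℝ) ≤ C * (oddRadical W : ℝ) * (W.conductorNorm ℤ : ℝ) ^ (6 + ε)

/-- **R1 `AllowanceDvd` (M — the allowance lemma, global form).** The odd-tower radical divides `d_K`.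
Local input: k3's L2 `dvd_discr_of_odd_ordMinDisc` (VERIFIED modulo H1 `Δ(W) = q² d_K`):
`ord_v Δ_min` odd ⇒ `p_v ∣ d_K`; globalise with `allowanceDvd_of_local` below (VERIFIED). -/
def AllowanceDvd : Prop :=
  ∀ (W : WeierstrassCurve ℚ) [W.IsElliptic] (K : Type) [Field K] [NumberField K],
    Irreducible W.twoTorsionPolynomial.toPoly → Module.finrank ℚ K = 3 →
    (∃ θ : K, aeval θ W.twoTorsionPolynomial.toPoly = 0) →
    (oddRadical W : ℤ) ∣ NumberField.discr K

/-- **R2 `AllowanceLe` (S from R1).** The real-valued form the composition consumes. -/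
def AllowanceLe : Prop :=
  ∀ (W : WeierstrassCurve ℚ) [W.IsElliptic] (K : Type) [Field K] [NumberField K],
    Irreducible W.twoTorsionPolynomial.toPoly → Module.finrank ℚ K = 3 →
    (∃ θ : K, aeval θ W.twoTorsionPolynomial.toPoly = 0) →
    (oddRadical W : ℝ) ≤ |(NumberField.discr K : ℝ)|

/-- (S, VERIFIED) `R1 → R2`: a divisor of the non-zero integer `d_K` is at most `|d_K|`. -/
theorem allowanceLe_of_dvd (h : AllowanceDvd) : AllowanceLe := by
  intro W _ K _ _ hirr h3 hθ
  have hdvd := h W K hirr h3 hθ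
  have hle : (oddRadical W : ℤ) ≤ |NumberField.discr K| :=
    Int.le_of_dvd (abs_pos.mpr (NumberField.discr_ne_zero K)) ((dvd_abs _ _).mpr hdvd)
  have : ((oddRadical W : ℤ) : ℝ) ≤ ((|NumberField.discr K| : ℤ) : ℝ) := by exact_mod_cast hle
  simpa [Int.cast_abs] using this

/-- (S, VERIFIED) LOCAL-TO-GLOBAL for R1, prime form: if every prime with odd exponent in `|Δ_min|`
divides `d_K`, the odd-tower radical divides `d_K` (distinct primes ⇒ product divides). -/
theorem allowanceDvd_of_primewise
    (hloc : ∀ (W : WeierstrassCurve ℚ) [W.IsElliptic] (K : Type) [Field K] [NumberField K],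
      Irreducible W.twoTorsionPolynomial.toPoly → Module.finrank ℚ K = 3 →
      (∃ θ : K, aeval θ W.twoTorsionPolynomial.toPoly = 0) →
      ∀ p : ℕ, p.Prime → Odd ((W.minimalDiscriminantNorm ℤ).factorization p) →
        (p : ℤ) ∣ NumberField.discr K) :
    AllowanceDvd := by
  intro W _ K _ _ hirr h3 hθ
  have hp := hloc W K hirr h3 hθ
  have hnat : oddRadical W ∣ (NumberField.discr K).natAbs := by
    refine Finset.prod_primes_dvd _ (fun p hp' => ?_) (fun p hp' => ?_)
    · exact (Nat.prime_of_mem_primeFactors (Finset.mem_filter.mp hp').1).prime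
    · have hm := Finset.mem_filter.mp hp'
      exact Int.ofNat_dvd_left.mp (hp p (Nat.prime_of_mem_primeFactors hm.1) hm.2)
  exact Int.ofNat_dvd_left.mpr hnat

/-- (S, VERIFIED) LOCAL-TO-GLOBAL for R1, place form = the exact shape of k3's L2: places `v` of `ℤ`,
`p_v = natGenerator v`, `ord_v Δ_min = (|Δ_min|).factorization p_v`
(`factorization_minimalDiscriminantNorm_holds`, PROVED in tree). -/
theorem allowanceDvd_of_local
    (hloc : ∀ (W : WeierstrassCurve ℚ) [W.IsElliptic] (K : Type) [Field K] [NumberField K],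
      Irreducible W.twoTorsionPolynomial.toPoly → Module.finrank ℚ K = 3 →
      (∃ θ : K, aeval θ W.twoTorsionPolynomial.toPoly = 0) →
      ∀ v : HeightOneSpectrum ℤ, Odd (W.ordMinimalDiscriminant v) →
        ((natGenerator v : ℕ) : ℤ) ∣ NumberField.discr K) :
    AllowanceDvd := by
  refine allowanceDvd_of_primewise fun W _ K _ _ hirr h3 hθ p hp hodd => ?_
  set v : HeightOneSpectrum ℤ := (primesEquiv (R := ℤ)).symm ⟨p, hp⟩ with hv
  have hgen : natGenerator v = p := by
    have h := (primesEquiv (R := ℤ)).apply_symm_apply ⟨p, hp⟩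
    exact congrArg Subtype.val h
  have hfac := W.factorization_minimalDiscriminantNorm_holds v
  rw [hgen] at hfac
  have hodd' : Odd (W.ordMinimalDiscriminant v) := by rwa [← hfac]
  have := hloc W K hirr h3 hθ v hodd'
  rwa [hgen] at this

/-- **R1 as a helper item (M).** Body = H1 (`Δ(W) = q² d_K`, k2 gen-1 / k3 H1) + k3 L2 + `allowanceDvd_of_local`. -/
theorem allowanceDvd : AllowanceDvd := by
  sorry

/-- **R3 (S, VERIFIED) — the re-cut composition, concluding the crux BY NAME.**
`OddTowerSzpiro → AllowanceLe → IndexSzpiro`. -/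
theorem indexSzpiro_of_oddTower (hK : OddTowerSzpiro) (hA : AllowanceLe) : IndexSzpiro := by
  intro ε hε
  obtain ⟨C, hC⟩ := hK ε hε
  refine ⟨max C 0, ?_⟩
  intro W _ K _ _ hirr h3 hθ
  have h1 := hC W hirr
  have hRle := hA W K hirr h3 hθ
  have hR0 : (0 : ℝ) ≤ (oddRadical W : ℝ) := Nat.cast_nonneg _
  have hN0 : (0 : ℝ) ≤ (W.conductorNorm ℤ : ℝ) ^ (6 + ε) := Real.rpow_nonneg (Nat.cast_nonneg _) _
  have hmax0 : (0 : ℝ) ≤ max C 0 := le_max_right _ _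
  calc (W.minimalDiscriminantNorm ℤ : ℝ)
      ≤ C * (oddRadical W : ℝ) * (W.conductorNorm ℤ : ℝ) ^ (6 + ε) := h1
    _ ≤ max C 0 * (oddRadical W : ℝ) * (W.conductorNorm ℤ : ℝ) ^ (6 + ε) :=
        mul_le_mul_of_nonneg_right (mul_le_mul_of_nonneg_right (le_max_left C 0) hR0) hN0
    _ ≤ max C 0 * |(NumberField.discr K : ℝ)| * (W.conductorNorm ℤ : ℝ) ^ (6 + ε) :=
        mul_le_mul_of_nonneg_right (mul_le_mul_of_nonneg_left hRle hmax0) hN0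

/-- The re-cut in skeleton clothing: the composition the lead would register INSTEAD of the sign
split (`stub_oddTowerSzpiro` OPEN kernel; `stub_allowanceDvd` M). -/
theorem IndexSzpiro_of' (h₁ : OddTowerSzpiro) (h₂ : AllowanceDvd) : IndexSzpiro :=
  indexSzpiro_of_oddTower h₁ (allowanceLe_of_dvd h₂)

/-- … and the current stubs drop out of it (so no work on the re-cut is lost for the old cut). -/
theorem stubComplex_of_recut (h₁ : OddTowerSzpiro) (h₂ : AllowanceDvd) : StubComplexCubic :=
  stubComplex_of_indexSzpiro (IndexSzpiro_of' h₁ h₂)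

/-! ## §T3 ε-free place-budget currency for the kernel (gen-3 technique E with ε and `K` removed) -/

/-- **K1 `PlaceBudgetOddTower` (OPEN, Szpiro-strength with an `ε = 0` place budget).** One absolute
`A ≥ 1`, one factor `A` per bad prime, exponent exactly `6`.  Consistent with Masser's
`Literature.Barriers.ABC.SzpiroEpsilonCannotBeDropped` (his families have `ω(N) → ∞`); in range it
needs `A ≥ e^{5.6}` (279366b1).  The `A^{#S}` shape is that of the COUNTING theory of `S`-unit
equations (`≤ 3·7^{d+2s}` solutions, Evertse 1984), not of Baker-type height bounds. -/
def PlaceBudgetOddTower : Prop :=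
  ∃ A : ℝ, 1 ≤ A ∧ ∀ (W : WeierstrassCurve ℚ) [W.IsElliptic],
    Irreducible W.twoTorsionPolynomial.toPoly →
    (W.minimalDiscriminantNorm ℤ : ℝ) ≤
      A ^ ((W.conductorNorm ℤ).primeFactors.card + 1) * (oddRadical W : ℝ) *
        (W.conductorNorm ℤ : ℝ) ^ (6 : ℝ)

/-- **(M, VERIFIED) the bootstrap `K1 → K0`:** `A^{ω(N)} ≤ exp(ε A^{1/ε}) · N^ε`
(`pow_card_primeFactors_le`, from `ω(N)! ≤ N`), so `C(ε) := A · exp(ε · A^{1/ε})`. -/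
theorem oddTower_of_placeBudget (h : PlaceBudgetOddTower) : OddTowerSzpiro := by
  obtain ⟨A, hA, hW⟩ := h
  intro ε hε
  refine ⟨A * Real.exp (ε * A ^ (1 / ε)), ?_⟩
  intro W _ hirr
  have h1 := hW W hirr
  have hNpos : 0 < W.conductorNorm ℤ := WeierstrassCurve.conductorNorm_pos_holds W
  have hNne : W.conductorNorm ℤ ≠ 0 := hNpos.ne'
  have hNreal : (0 : ℝ) < (W.conductorNorm ℤ : ℝ) := by exact_mod_cast hNpos
  have hbudget : A ^ (W.conductorNorm ℤ).primeFactors.card ≤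
      Real.exp (ε * A ^ (1 / ε)) * ((W.conductorNorm ℤ : ℕ) : ℝ) ^ ε :=
    pow_card_primeFactors_le hA hε hNne
  have hA0 : (0 : ℝ) ≤ A := le_trans zero_le_one hA
  have hR0 : (0 : ℝ) ≤ (oddRadical W : ℝ) := Nat.cast_nonneg _
  have hN0 : (0 : ℝ) ≤ (W.conductorNorm ℤ : ℝ) ^ (6 : ℝ) := Real.rpow_nonneg (Nat.cast_nonneg _) _
  have hsplit : (W.conductorNorm ℤ : ℝ) ^ ε * (W.conductorNorm ℤ : ℝ) ^ (6 : ℝ) =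
      (W.conductorNorm ℤ : ℝ) ^ (6 + ε) := by
    rw [← Real.rpow_add hNreal]; ring_nf
  calc (W.minimalDiscriminantNorm ℤ : ℝ)
      ≤ A ^ ((W.conductorNorm ℤ).primeFactors.card + 1) * (oddRadical W : ℝ) *
          (W.conductorNorm ℤ : ℝ) ^ (6 : ℝ) := h1
    _ = A * A ^ (W.conductorNorm ℤ).primeFactors.card * (oddRadical W : ℝ) *
          (W.conductorNorm ℤ : ℝ) ^ (6 : ℝ) := by rw [pow_succ]; ring
    _ ≤ A * (Real.exp (ε * A ^ (1 / ε)) * (W.conductorNorm ℤ : ℝ) ^ ε) *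
          (oddRadical W : ℝ) * (W.conductorNorm ℤ : ℝ) ^ (6 : ℝ) :=
        mul_le_mul_of_nonneg_right (mul_le_mul_of_nonneg_right
          (mul_le_mul_of_nonneg_left hbudget hA0) hR0) hN0
    _ = A * Real.exp (ε * A ^ (1 / ε)) * (oddRadical W : ℝ) *
          ((W.conductorNorm ℤ : ℝ) ^ ε * (W.conductorNorm ℤ : ℝ) ^ (6 : ℝ)) := by ring
    _ = A * Real.exp (ε * A ^ (1 / ε)) * (oddRadical W : ℝ) *
          (W.conductorNorm ℤ : ℝ) ^ (6 + ε) := by rw [hsplit]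

/-- The whole gen-4 chain, kernel-checked: `K1 → K0 → (R1 →) IndexSzpiro → stub_complexCubic`. -/
theorem stubComplex_of_placeBudget (h₁ : PlaceBudgetOddTower) (h₂ : AllowanceDvd) : StubComplexCubic :=
  stubComplex_of_recut (oddTower_of_placeBudget h₁) h₂

end Summit.ABC.ABC.Cruxes.IndexSzpiro.StubIdeas2G4
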